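import Mathlib
import Summits.Ventures.PercRepro2.ReimerUnion

/-!
# Union Reimer with the restriction flipped to the target (PercRepro2, mine-1)

`reimer_union_flip` (`MINE-1.md` §17.9): for increasing `E₁ ⊆ E₂`, `F₂ ⊆ F₁`, `C` on the cube `U`,

  `#{S : (E₁ □ F₁ ∨ E₂ □ F₂) at S, U \ S ∈ C} ≤ #{S : (S ∈ E₁ ∧ U \ S ∈ F₁) ∨ (S ∈ E₂ ∧ U \ S ∈ F₂), S ∈ C}`

— the union Reimer inequality `reimer_union_decr` with the decreasing restriction `{blue ∈ C}` moved to
the INCREASING restriction `{red ∈ C}` on the target, as in `reimer_restrict_bar_flip`.  Same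
Bollobás–Leader induction; the level-0 excess on `D₀ \ D₁` is now absorbed by the induction
hypothesis for the `E`-sections `(E₁₁, E₂₁; F₁, F₂)` on the larger set `D₀`.

For Conjecture AC (`MINE-1.md` §14.4) with `E₁ = A ∩ C`, `E₂ = A`, `F₁ = B`, `F₂ = B ∩ C` this bounds
`ℒ = ℒ₁ ∪ ℒ₂` by `#{A ∩ B̄ ∩ C}` (`ac_union_le_red`), the mirror of `reimer_union_decr`'s bound
`#{A ∩ B̄ ∩ C̄}`; AC asks for the intersection `#{A ∩ B̄ ∩ C ∩ C̄}`.
-/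

namespace Summit.Ventures.PercRepro2

namespace ReimerCube

variable {E : Type*} [DecidableEq E]

open Classical in
/-- **Union Reimer with the restriction flipped (MINE-1 §17.9).**  For increasing `E₁ ⊆ E₂`,
`F₂ ⊆ F₁`, `C` and a ground set `U`:
`#{S ⊆ U : (E₁ □ F₁ ∨ E₂ □ F₂) ∧ C (U \ S)} ≤ #{S ⊆ U : ((E₁ S ∧ F₁ (U \ S)) ∨ (E₂ S ∧ F₂ (U \ S))) ∧ C S}`. -/
theorem reimer_union_flip (U : Finset E) :
    ∀ (E₁ E₂ F₁ F₂ C : Finset E → Prop), Incr E₁ → Incr E₂ → Incr F₁ → Incr F₂ → Incr C →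
      (∀ S, E₁ S → E₂ S) → (∀ S, F₂ S → F₁ S) →
      (U.powerset.filter (fun S => (DOcc E₁ F₁ S ∨ DOcc E₂ F₂ S) ∧ C (U \ S))).card
        ≤ (U.powerset.filter
            (fun S => ((E₁ S ∧ F₁ (U \ S)) ∨ (E₂ S ∧ F₂ (U \ S))) ∧ C S)).card := by
  induction U using Finset.induction_on with
  | empty =>
    intro E₁ E₂ F₁ F₂ C _ _ _ _ _ _ _
    apply Finset.card_le_card
    intro S hS
    rw [Finset.mem_filter, Finset.mem_powerset] at hS ⊢
    obtain ⟨hS0, hD, hCS⟩ := hS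
    have hS0' : S = ∅ := Finset.subset_empty.mp hS0
    subst hS0'
    refine ⟨Finset.Subset.refl _, ?_, by simpa using hCS⟩
    rcases hD with ⟨K, L, hK, hL, -, hAK, hBL⟩ | ⟨K, L, hK, hL, -, hAK, hBL⟩
    · exact Or.inl ⟨hAK _ hK, hBL _ (hL.trans (Finset.empty_subset _))⟩
    · exact Or.inr ⟨hAK _ hK, hBL _ (hL.trans (Finset.empty_subset _))⟩
  | insert i U hi ih =>
    intro E₁ E₂ F₁ F₂ C hE₁ hE₂ hF₁ hF₂ hC h12 h21
    rw [card_filter_powerset_insert hi, card_filter_powerset_insert hi]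
    have e0 : U.powerset.filter (fun S => (DOcc E₁ F₁ S ∨ DOcc E₂ F₂ S) ∧ C (insert i U \ S))
        = U.powerset.filter (fun S => (DOcc E₁ F₁ S ∨ DOcc E₂ F₂ S) ∧ sec1 i C (U \ S)) := by
      apply Finset.filter_congr
      intro S hS
      rw [insert_sdiff_of_not_mem' (Finset.mem_powerset.mp hS) hi]
      rfl
    have e1 : U.powerset.filter
          (fun S => (DOcc E₁ F₁ (insert i S) ∨ DOcc E₂ F₂ (insert i S)) ∧ C (insert i U \ insert i S))
        = U.powerset.filter (fun S => ((DOcc E₁ (sec1 i F₁) S ∨ DOcc E₂ (sec1 i F₂) S) ∨ (DOcc (sec1 i E₁) F₁ S ∨ DOcc (sec1 i E₂) F₂ S)) ∧ C (U \ S)) := by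
      apply Finset.filter_congr
      intro S hS
      have hiS : i ∉ S := fun h => hi (Finset.mem_powerset.mp hS h)
      rw [dOcc_insert_iff hF₁ hiS, dOcc_insert_iff hF₂ hiS, insert_sdiff_insert' hi]
      constructor
      · rintro ⟨h, hd⟩
        exact ⟨by tauto, hd⟩
      · rintro ⟨h, hd⟩
        exact ⟨by tauto, hd⟩
    have e2 : U.powerset.filter
          (fun S => ((E₁ S ∧ F₁ (insert i U \ S)) ∨ (E₂ S ∧ F₂ (insert i U \ S))) ∧ C S)
        = U.powerset.filter
            (fun S => ((E₁ S ∧ sec1 i F₁ (U \ S)) ∨ (E₂ S ∧ sec1 i F₂ (U \ S))) ∧ C S) := by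
      apply Finset.filter_congr
      intro S hS
      rw [insert_sdiff_of_not_mem' (Finset.mem_powerset.mp hS) hi]
      rfl
    have e3 : U.powerset.filter (fun S =>
          ((E₁ (insert i S) ∧ F₁ (insert i U \ insert i S))
            ∨ (E₂ (insert i S) ∧ F₂ (insert i U \ insert i S))) ∧ C (insert i S))
        = U.powerset.filter
            (fun S => ((sec1 i E₁ S ∧ F₁ (U \ S)) ∨ (sec1 i E₂ S ∧ F₂ (U \ S))) ∧ sec1 i C S) := by
      apply Finset.filter_congr
      intro S _
      rw [insert_sdiff_insert' hi]
      rfl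
    rw [e0, e1, e2, e3]
    have hD10 : ∀ S, C (U \ S) → sec1 i C (U \ S) := fun S h => incr_le_sec1 hC i _ h
    -- Z ⊆ X and Z ⊆ Y
    have hZX : ∀ S, (DOcc E₁ F₁ S ∨ DOcc E₂ F₂ S) → (DOcc E₁ (sec1 i F₁) S ∨ DOcc E₂ (sec1 i F₂) S) := by
      intro S h
      rcases h with h | h
      · exact Or.inl (h.mono_right (incr_le_sec1 hF₁ i))
      · exact Or.inr (h.mono_right (incr_le_sec1 hF₂ i))
    have hZY : ∀ S, (DOcc E₁ F₁ S ∨ DOcc E₂ F₂ S) → (DOcc (sec1 i E₁) F₁ S ∨ DOcc (sec1 i E₂) F₂ S) := by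
      intro S h
      rcases h with h | h
      · exact Or.inl (h.mono_left (incr_le_sec1 hE₁ i))
      · exact Or.inr (h.mono_left (incr_le_sec1 hE₂ i))
    -- inclusion–exclusion at level 1 inside D₁ = {C (U \ S)}
    have hU : U.powerset.filter (fun S => ((DOcc E₁ (sec1 i F₁) S ∨ DOcc E₂ (sec1 i F₂) S) ∨ (DOcc (sec1 i E₁) F₁ S ∨ DOcc (sec1 i E₂) F₂ S)) ∧ C (U \ S))
        = U.powerset.filter (fun S => (DOcc E₁ (sec1 i F₁) S ∨ DOcc E₂ (sec1 i F₂) S) ∧ C (U \ S))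
          ∪ U.powerset.filter (fun S => (DOcc (sec1 i E₁) F₁ S ∨ DOcc (sec1 i E₂) F₂ S) ∧ C (U \ S)) := by
      ext S
      simp only [Finset.mem_filter, Finset.mem_union]
      tauto
    have hI : U.powerset.filter (fun S => ((DOcc E₁ (sec1 i F₁) S ∨ DOcc E₂ (sec1 i F₂) S) ∧ (DOcc (sec1 i E₁) F₁ S ∨ DOcc (sec1 i E₂) F₂ S)) ∧ C (U \ S))
        = U.powerset.filter (fun S => (DOcc E₁ (sec1 i F₁) S ∨ DOcc E₂ (sec1 i F₂) S) ∧ C (U \ S))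
          ∩ U.powerset.filter (fun S => (DOcc (sec1 i E₁) F₁ S ∨ DOcc (sec1 i E₂) F₂ S) ∧ C (U \ S)) := by
      ext S
      simp only [Finset.mem_filter, Finset.mem_inter]
      tauto
    have h_or := Finset.card_union_add_card_inter
      (U.powerset.filter (fun S => (DOcc E₁ (sec1 i F₁) S ∨ DOcc E₂ (sec1 i F₂) S) ∧ C (U \ S)))
      (U.powerset.filter (fun S => (DOcc (sec1 i E₁) F₁ S ∨ DOcc (sec1 i E₂) F₂ S) ∧ C (U \ S)))
    rw [← hU, ← hI] at h_or
    have h_sub : (U.powerset.filter (fun S => (DOcc E₁ F₁ S ∨ DOcc E₂ F₂ S) ∧ C (U \ S))).card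
        ≤ (U.powerset.filter (fun S => ((DOcc E₁ (sec1 i F₁) S ∨ DOcc E₂ (sec1 i F₂) S) ∧ (DOcc (sec1 i E₁) F₁ S ∨ DOcc (sec1 i E₂) F₂ S)) ∧ C (U \ S))).card := by
      apply Finset.card_le_card
      intro S hS
      rw [Finset.mem_filter] at hS ⊢
      exact ⟨hS.1, ⟨hZX S hS.2.1, hZY S hS.2.1⟩, hS.2.2⟩
    -- split the level-0 counts along D₁ ⊆ D₀ = {C₁ (U \ S)}
    have hs1 : (U.powerset.filter (fun S => (DOcc E₁ F₁ S ∨ DOcc E₂ F₂ S) ∧ sec1 i C (U \ S))).card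
        = (U.powerset.filter (fun S => (DOcc E₁ F₁ S ∨ DOcc E₂ F₂ S) ∧ C (U \ S))).card
          + (U.powerset.filter (fun S => (DOcc E₁ F₁ S ∨ DOcc E₂ F₂ S) ∧ sec1 i C (U \ S) ∧ ¬ C (U \ S))).card := by
      have h := Finset.card_filter_add_card_filter_not
        (s := U.powerset.filter (fun S => (DOcc E₁ F₁ S ∨ DOcc E₂ F₂ S) ∧ sec1 i C (U \ S))) (fun S => C (U \ S))
      rw [Finset.filter_filter, Finset.filter_filter] at h
      have f1 : U.powerset.filter (fun S => ((DOcc E₁ F₁ S ∨ DOcc E₂ F₂ S) ∧ sec1 i C (U \ S)) ∧ C (U \ S))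
          = U.powerset.filter (fun S => (DOcc E₁ F₁ S ∨ DOcc E₂ F₂ S) ∧ C (U \ S)) := by
        apply Finset.filter_congr
        intro S _
        constructor
        · rintro ⟨⟨h1, -⟩, h3⟩
          exact ⟨h1, h3⟩
        · rintro ⟨h1, h3⟩
          exact ⟨⟨h1, hD10 S h3⟩, h3⟩
      have f2 : U.powerset.filter (fun S => ((DOcc E₁ F₁ S ∨ DOcc E₂ F₂ S) ∧ sec1 i C (U \ S)) ∧ ¬ C (U \ S))
          = U.powerset.filter (fun S => (DOcc E₁ F₁ S ∨ DOcc E₂ F₂ S) ∧ sec1 i C (U \ S) ∧ ¬ C (U \ S)) := by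
        apply Finset.filter_congr
        intro S _
        tauto
      rw [f1, f2] at h
      omega
    have hs2 : (U.powerset.filter (fun S => (DOcc (sec1 i E₁) F₁ S ∨ DOcc (sec1 i E₂) F₂ S) ∧ sec1 i C (U \ S))).card
        = (U.powerset.filter (fun S => (DOcc (sec1 i E₁) F₁ S ∨ DOcc (sec1 i E₂) F₂ S) ∧ C (U \ S))).card
          + (U.powerset.filter (fun S => (DOcc (sec1 i E₁) F₁ S ∨ DOcc (sec1 i E₂) F₂ S) ∧ sec1 i C (U \ S) ∧ ¬ C (U \ S))).card := by
      have h := Finset.card_filter_add_card_filter_not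
        (s := U.powerset.filter (fun S => (DOcc (sec1 i E₁) F₁ S ∨ DOcc (sec1 i E₂) F₂ S) ∧ sec1 i C (U \ S))) (fun S => C (U \ S))
      rw [Finset.filter_filter, Finset.filter_filter] at h
      have f1 : U.powerset.filter (fun S => ((DOcc (sec1 i E₁) F₁ S ∨ DOcc (sec1 i E₂) F₂ S) ∧ sec1 i C (U \ S)) ∧ C (U \ S))
          = U.powerset.filter (fun S => (DOcc (sec1 i E₁) F₁ S ∨ DOcc (sec1 i E₂) F₂ S) ∧ C (U \ S)) := by
        apply Finset.filter_congr
        intro S _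
        constructor
        · rintro ⟨⟨h1, -⟩, h3⟩
          exact ⟨h1, h3⟩
        · rintro ⟨h1, h3⟩
          exact ⟨⟨h1, hD10 S h3⟩, h3⟩
      have f2 : U.powerset.filter (fun S => ((DOcc (sec1 i E₁) F₁ S ∨ DOcc (sec1 i E₂) F₂ S) ∧ sec1 i C (U \ S)) ∧ ¬ C (U \ S))
          = U.powerset.filter (fun S => (DOcc (sec1 i E₁) F₁ S ∨ DOcc (sec1 i E₂) F₂ S) ∧ sec1 i C (U \ S) ∧ ¬ C (U \ S)) := by
        apply Finset.filter_congr
        intro S _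
        tauto
      rw [f1, f2] at h
      omega
    -- on D₀ \ D₁: Z ⊆ Y
    have h_sub2 : (U.powerset.filter (fun S => (DOcc E₁ F₁ S ∨ DOcc E₂ F₂ S) ∧ sec1 i C (U \ S) ∧ ¬ C (U \ S))).card
        ≤ (U.powerset.filter (fun S => (DOcc (sec1 i E₁) F₁ S ∨ DOcc (sec1 i E₂) F₂ S) ∧ sec1 i C (U \ S) ∧ ¬ C (U \ S))).card := by
      apply Finset.card_le_card
      intro S hS
      rw [Finset.mem_filter] at hS ⊢
      exact ⟨hS.1, hZY S hS.2.1, hS.2.2⟩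
    have ih1 := ih E₁ E₂ (sec1 i F₁) (sec1 i F₂) C hE₁ hE₂ (incr_sec1 hF₁ i) (incr_sec1 hF₂ i) hC
      h12 (fun S h => h21 _ h)
    have ih2 := ih (sec1 i E₁) (sec1 i E₂) F₁ F₂ (sec1 i C) (incr_sec1 hE₁ i) (incr_sec1 hE₂ i)
      hF₁ hF₂ (incr_sec1 hC i) (fun S h => h12 _ h) h21
    omega

/-- Comparing the sizes of two filters of the same set when one predicate implies the other,
whatever the decidability instances. -/
lemma card_filter_le_card_filter_of_imp {α : Type*} {s : Finset α} {p q : α → Prop}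
    {dp : DecidablePred p} {dq : DecidablePred q} (h : ∀ x ∈ s, p x → q x) :
    (@Finset.filter α p dp s).card ≤ (@Finset.filter α q dq s).card := by
  apply Finset.card_le_card
  intro x hx
  rw [@Finset.mem_filter _ _ dp] at hx
  rw [@Finset.mem_filter _ _ dq]
  exact ⟨hx.1, h x hx.1 hx.2⟩

open Classical in
/-- The AC union `ℒ = ((A∩C) □ B ∪ A □ (B∩C)) ∩ {blue ∈ C}` is bounded by `#{A ∩ B̄ ∩ C}` (red `s ↔ t`),
the mirror of `reimer_union_decr`'s bound `#{A ∩ B̄ ∩ C̄}` (blue `s ↔ t`); Conjecture AC asks for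
`#{A ∩ B̄ ∩ C ∩ C̄}`. -/
theorem ac_union_le_red (U : Finset E) (A B C : Finset E → Prop) (hA : Incr A) (hB : Incr B)
    (hC : Incr C) :
    (U.powerset.filter (fun S =>
        (DOcc (fun T => A T ∧ C T) B S ∨ DOcc A (fun T => B T ∧ C T) S) ∧ C (U \ S))).card
      ≤ (U.powerset.filter (fun S => A S ∧ B (U \ S) ∧ C S)).card := by
  have hAC : Incr (fun T => A T ∧ C T) := fun _ _ h hx => ⟨hA h hx.1, hC h hx.2⟩
  have hBC : Incr (fun T => B T ∧ C T) := fun _ _ h hx => ⟨hB h hx.1, hC h hx.2⟩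
  have h := reimer_union_flip U (fun T => A T ∧ C T) A B (fun T => B T ∧ C T) C hAC hA hB hBC hC
    (fun _ h => h.1) (fun _ h => h.1)
  refine h.trans (card_filter_le_card_filter_of_imp ?_)
  intro S _ hS
  obtain ⟨hS1, hCS⟩ := hS
  rcases hS1 with ⟨⟨hA', _⟩, hB'⟩ | ⟨hA', ⟨hB', _⟩⟩
  · exact ⟨hA', hB', hCS⟩
  · exact ⟨hA', hB', hCS⟩

end ReimerCube

end Summit.Ventures.PercRepro2
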